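import Summits.QuantumFields.BalabanUV.T4Continuum.Spine.NE5.LeafIndex
import Summits.QuantumFields.BalabanUV.T4Continuum.Support.OutputRateArithmetic

/-!
# Spine/NE5/SmallnessPrintedKind — row NE5 (node U3), route P1: the SHARP smallness leaf L11 (`ω + Λ·c < θ′`) and the reach
# leaf L10 DISCHARGED INTO ε₁-SMALLNESS CONDITIONS, once the insertion gain is written `c = cI·ε₁`

Cell `pub-balaban-gaps` (YM blitz Y1, track G2), seat `ne5` (`prover-pub-balaban-gaps-ne5-g0-0`), triage sheet `HOME/ne/NE5.md` §4 (M5) / §6 T1.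
Imports the typer's leaf index `Spine/NE5/LeafIndex` (faces E1 ∕ E1′ BY NAME) and the arithmetic leaf `Support/OutputRateArithmetic`
(`reach_binders_exists`); modifies nothing.

WHY `c = cI·ε₁` ([analysis] of this seat — a READING of print, not an assertion of it; the binder below is a hypothesis shape like every
other leaf).  In the step model the letter `c` of L09∕W3 (`StepModel.InsScaleBound W κ E₁ c ω`, consumed as `InsertionDampedNat W κ c ω`)
is the INSERTION GAIN: how far (in history-margin units) a unit-level table of earlier-scale terms moves the history inserted into the
step-k fluctuation integral.  In [Balaban1988RG2Cluster] (= [II]) that inserted history is the fluctuation of the earlier actions under the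
small fluctuation field, (1.22)–(1.24) p. 7, and its sum at a localization domain is bounded on p. 8 by (1.29) «|Σ(1.23)| ≤ E₀ε₁O(M^q)
exp O(1)κ₁ exp(−½κ₁d_k(Y))» — LINEAR in the table level E₀ and PROPORTIONAL TO ε₁, the small-field cut of the fluctuation variable
([Balaban1987RG1] (2.9) p. 266 «χ_k = Π_b χ({|B′(b)| < ε₁})»; [II] (1.20) p. 6 «… ≤ C₁g_k|B| < C₁ε₁ … and g_k|B| < ε₁»), with Bałaban's
own remark (p. 8) «Another possibility is to use the expression g_k|B| instead of ε₁. It gives a better bound, but the above is simpler.»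
The level E₀ itself is ε₁-INDEPENDENT (p. 21: «We define ½E₀ as equal to this constant» — the absolute constant of the random-walk
boundary terms — and «Next, we assume that O(1)C₃ε₁ ≤ ½E₀. In fact this assumption is unessential, because the constant C₃ε₁ is small
anyway»).  Hence, READ ON BAŁABAN'S LETTERS, the gain has the form `c = cI·ε₁` with `cI` built from L, M, κ₁ and O(1)'s (the count
«(6L)⁴» of p. 8, «O(M^q) exp O(1)κ₁» of (1.29)) and NOT from ε₁ or E₀.  Under that reading the two arithmetic leaves of the route —
L11 SMALLNESS `ω + G/(1−ρ₀)·c < θ′` (SHARP at the typed interface: `T4InputCauchyRateSharp.sharp_ne5_iff`) and the history half of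
L10 REACH `c(EA₀+E₀)/(1−ω) < ρ₀` — are ε₁-SMALLNESS CONDITIONS of exactly the kind [II] imposes on its auxiliary constants (p. 7 «if
e^{32κ₁}ε₁ is smaller than an absolute constant», p. 20 «Assuming that 2(L + 2)⁴O(1)ε₂ exp 5κ ≤ 1», p. 21 «for κ sufficiently large, and
ε₁ sufficiently small»), chosen LAST in the printed order of constants (L, M, κ, κ₁, α's before ε's).  This file is the kernel form of
that sentence: (§1) the two leaves follow from `G·cI·ε₁ < (θ′ − ω)(1 − ρ₀)` and `cI·ε₁·(EA₀ + E₀) < ρ₀(1 − ω)`; (§2) for any target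
rate `θ′ > ω` and any analytic reach `0 < ρ₀ < 1` ONE threshold `ε⋆ > 0` makes both hold for every `0 ≤ ε₁ < ε⋆`, monotonically;
(§3) the END faces E1′ ∕ E1 of `LeafIndex` with L10 ∧ L11 REPLACED by the two ε₁-conditions, and the fully discharged form
«leaves L01–L09 at gain cI·ε₁ ∧ ε₁ < ε⋆ ⟹ ∃ C₅, NE5».

HONEST FRAMING.  NE5 (`T4OutputRate.NE5`) is a cell NEW ESTIMATE — NOT PRINTED (GAPS G-t4-U3-1) and NOT PROVED; this file is real
arithmetic over an ABSTRACT `StepModel`; it instantiates NO leaf on Bałaban's objects (0/12 unchanged) and does not decide the value of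
any printed O(1).  What it changes is the BOOKING of leaf L11/L10 in the census (from «every letter O(1)-symbolic ⇒ no numeric
instance» to «an ε₁-smallness side condition with explicit threshold shape ε⋆ = min((θ′−ω)(1−ρ₀)/(G·cI+1), ρ₀(1−ω)/(cI(EA₀+E₀)+1))»).
Rung (B)+1 bookkeeping on a FIXED finite T⁴ — NOT the continuum limit by itself, NOT infinite volume, NOT a mass gap, NOT Clay.  Spine
PROVED 0/9.  HONEST DEPENDENCY: continuum YM on T⁴ ⇐ BetaPertH ∧ nine spine estimates (0/9 proved); BetaPertH ⇐ (D1) ∧ (D4) ∧ CAP+tail.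
0 sorry; axioms standard; 0 cite tags (nothing printed is asserted; the «…» above are context for a READING).
-/

noncomputable section

open Set Metric

namespace Summit.QuantumFields.BalabanUV.T4Continuum.Spine.NE5

open Literature.MathematicalPhysics.QuantumFieldTheory.Balaban1983to89
open Literature.MathematicalPhysics.QuantumFieldTheory.Balaban1983to89.T4OutputRate
open Literature.MathematicalPhysics.QuantumFieldTheory.Balaban1983to89.T4InputCauchyRateData
open Summit.QuantumFields.BalabanUV.T4Continuum.OutputRateArithmetic

/-! ## §1 The two arithmetic leaves from ε₁-smallness -/

section Arithmetic

/-- **L11 FROM ε₁-SMALLNESS (fibre currency, `Λ = G/(1 − ρ₀)`)**: with the insertion gain `c = cI·ε₁`, the sharp smallness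
`ω + G/(1−ρ₀)·(cI·ε₁) < θ′` of the Cauchy route follows from `G·cI·ε₁ < (θ′ − ω)(1 − ρ₀)` at any analytic reach `ρ₀ < 1`. [folklore] -/
theorem smallness_of_eps {G cI ε₁ θ' ω ρ₀ : ℝ} (hρ₀ : ρ₀ < 1) (h : G * cI * ε₁ < (θ' - ω) * (1 - ρ₀)) :
    ω + G / (1 - ρ₀) * (cI * ε₁) < θ' := by
  have h1 : 0 < 1 - ρ₀ := sub_pos.mpr hρ₀
  have h2 : G / (1 - ρ₀) * (cI * ε₁) = G * cI * ε₁ / (1 - ρ₀) := by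
    rw [div_mul_eq_mul_div]; ring
  have h3 : G * cI * ε₁ / (1 - ρ₀) < θ' - ω := (div_lt_iff₀ h1).mpr h
  rw [h2]; linarith

/-- **L11 FROM ε₁-SMALLNESS (consumed currency, one modulus `Λ`)**: `ω + Λ·(cI·ε₁) < θ′` from `Λ·cI·ε₁ < θ′ − ω`. [folklore] -/
theorem smallnessMod_of_eps {Λ cI ε₁ θ' ω : ℝ} (h : Λ * cI * ε₁ < θ' - ω) : ω + Λ * (cI * ε₁) < θ' := by
  have h2 : Λ * (cI * ε₁) = Λ * cI * ε₁ := by ring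
  rw [h2]; linarith

/-- **L10 (history half) FROM ε₁-SMALLNESS**: with `c = cI·ε₁` the strict reach `c(EA₀ + E₀)/(1 − ω) < ρ₀` follows from
`cI·ε₁·(EA₀ + E₀) < ρ₀(1 − ω)` for an age damping `ω < 1`. [folklore] -/
theorem reach_of_eps {cI ε₁ EA₀ E₀ ω ρ₀ : ℝ} (hω1 : ω < 1) (h : cI * ε₁ * (EA₀ + E₀) < ρ₀ * (1 - ω)) :
    cI * ε₁ * (EA₀ + E₀) / (1 - ω) < ρ₀ :=
  (div_lt_iff₀ (sub_pos.mpr hω1)).mpr h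

/-- Both ε₁-conditions are MONOTONE: they persist for every smaller `ε₁′ ≤ ε₁` (nonnegative coefficient). [folklore] -/
theorem eps_condition_mono {a ε₁ ε₁' T : ℝ} (ha : 0 ≤ a) (hle : ε₁' ≤ ε₁) (h : a * ε₁ < T) : a * ε₁' < T :=
  lt_of_le_of_lt (mul_le_mul_of_nonneg_left hle ha) h

end Arithmetic

/-! ## §2 One threshold ε⋆ > 0 for both leaves -/

section Threshold

/-- Generic threshold: for `a ≥ 0` and `T > 0`, every `x < T/(a + 1)` has `a·x < T`. [folklore] -/
theorem mul_lt_of_lt_threshold {a T x : ℝ} (ha : 0 ≤ a) (hT : 0 < T) (hx : x < T / (a + 1)) : a * x < T := by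
  have ha1 : 0 < a + 1 := by linarith
  have h1 : a * x ≤ a * (T / (a + 1)) := mul_le_mul_of_nonneg_left hx.le ha
  have h2 : a * (T / (a + 1)) < T := by
    rw [mul_div_assoc', div_lt_iff₀ ha1]; nlinarith
  exact lt_of_le_of_lt h1 h2

/-- **THE THRESHOLD ε⋆**: for a target rate `θ′ > ω`, an age damping `ω < 1`, an analytic reach `0 < ρ₀ < 1`, an envelope constant
`G ≥ 0`, a gain coefficient `cI ≥ 0` and levels `EA₀ + E₀ ≥ 0`, the explicit
`ε⋆ = min ((θ′ − ω)(1 − ρ₀)/(G·cI + 1)) (ρ₀(1 − ω)/(cI·(EA₀ + E₀) + 1)) > 0` makes BOTH ε₁-conditions of §1 hold for every `ε₁ < ε⋆`.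
[folklore] -/
theorem eps_threshold {G cI EA₀ E₀ θ' ω ρ₀ : ℝ} (hG : 0 ≤ G) (hcI : 0 ≤ cI) (hE : 0 ≤ EA₀ + E₀) (hωθ' : ω < θ')
    (hω1 : ω < 1) (hρ₀0 : 0 < ρ₀) (hρ₀1 : ρ₀ < 1) :
    0 < min ((θ' - ω) * (1 - ρ₀) / (G * cI + 1)) (ρ₀ * (1 - ω) / (cI * (EA₀ + E₀) + 1)) ∧
      ∀ ε₁, ε₁ < min ((θ' - ω) * (1 - ρ₀) / (G * cI + 1)) (ρ₀ * (1 - ω) / (cI * (EA₀ + E₀) + 1)) →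
        G * cI * ε₁ < (θ' - ω) * (1 - ρ₀) ∧ cI * ε₁ * (EA₀ + E₀) < ρ₀ * (1 - ω) := by
  have hT1 : 0 < (θ' - ω) * (1 - ρ₀) := mul_pos (sub_pos.mpr hωθ') (sub_pos.mpr hρ₀1)
  have hT2 : 0 < ρ₀ * (1 - ω) := mul_pos hρ₀0 (sub_pos.mpr hω1)
  have ha1 : 0 ≤ G * cI := mul_nonneg hG hcI
  have ha2 : 0 ≤ cI * (EA₀ + E₀) := mul_nonneg hcI hE
  refine ⟨lt_min (div_pos hT1 (by linarith)) (div_pos hT2 (by linarith)), fun ε₁ hε => ⟨?_, ?_⟩⟩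
  · exact mul_lt_of_lt_threshold ha1 hT1 (lt_of_lt_of_le hε (min_le_left _ _))
  · have h := mul_lt_of_lt_threshold ha2 hT2 (lt_of_lt_of_le hε (min_le_right _ _))
    calc cI * ε₁ * (EA₀ + E₀) = cI * (EA₀ + E₀) * ε₁ := by ring
      _ < ρ₀ * (1 - ω) := h

/-- Existential form of `eps_threshold`. [folklore] -/
theorem eps_threshold_exists {G cI EA₀ E₀ θ' ω ρ₀ : ℝ} (hG : 0 ≤ G) (hcI : 0 ≤ cI) (hE : 0 ≤ EA₀ + E₀) (hωθ' : ω < θ')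
    (hω1 : ω < 1) (hρ₀0 : 0 < ρ₀) (hρ₀1 : ρ₀ < 1) :
    ∃ εs : ℝ, 0 < εs ∧ ∀ ε₁, ε₁ < εs → G * cI * ε₁ < (θ' - ω) * (1 - ρ₀) ∧ cI * ε₁ * (EA₀ + E₀) < ρ₀ * (1 - ω) :=
  ⟨_, (eps_threshold hG hcI hE hωθ' hω1 hρ₀0 hρ₀1).1, (eps_threshold hG hcI hE hωθ' hω1 hρ₀0 hρ₀1).2⟩

end Threshold

/-! ## §3 The END faces with L11 (and L10) replaced by ε₁-smallness -/

section Faces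

variable {C : Carriers} {Op Hist : Type*} [NormedAddCommGroup Op] [NormedSpace ℂ Op] [NormedAddCommGroup Hist]
  [NormedSpace ℂ Hist] (M : StepModel C Op Hist)

/-- **E1′ AT GAIN `cI·ε₁` WITH L11 := ε₁-SMALLNESS** — `LeafIndex.ne5_of_leaves_fibre` BY NAME with its binder `l11 : ω + G/(1−ρ₀)·c < θ′`
replaced by `G·cI·ε₁ < (θ′ − ω)(1 − ρ₀)`; every wall (L04op, L04hist, L09unit, …) in its most primitive typed form, L10 still displayed.
[folklore] -/
theorem ne5_of_leaves_fibre_eps {EA : Functional C C.BgA} {EB : Functional C C.BgB} {W : Set (ℕ → ℝ)}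
    {κ G EA₀ E₀ E₁ δ δ' θ θ' cI ε₁ ω ρ₀ B : ℝ} {k₀ : ℕ} (l01 : L01 M EA W) (l02 : L02 M EB W) (l03 : L03 M EB W)
    (l04op : L04op M W κ G) (l04hist : L04hist M W κ G) (l05 : L05 EA W EA₀ κ) (l06 : L06 EB W E₀ κ)
    (l07 : L07 M W δ θ) (l08 : L08 M W κ E₀ δ' θ) (l09aff : L09aff M W) (l09blind : L09blind M W) (l09hom : L09hom M W)
    (l09unit : L09unit M W κ E₁ (cI * ε₁) ω) (hE₁ : 0 < E₁) (hG : 0 ≤ G) (hδ : 0 ≤ δ + δ') (hθ : 0 ≤ θ) (hθθ' : θ ≤ θ')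
    (hθ'1 : θ' ≤ 1) (hcI : 0 ≤ cI) (hε₁ : 0 ≤ ε₁) (hω : 0 < ω) (hρ₀ : ρ₀ < 1)
    (l10near : (δ + δ') * θ ^ k₀ + cI * ε₁ * (EA₀ + E₀) / (1 - ω) ≤ ρ₀) (hB : 0 ≤ B)
    (l10first : ∀ k < k₀, EA₀ + E₀ ≤ B * θ ^ k) (hsmall : G * cI * ε₁ < (θ' - ω) * (1 - ρ₀)) :
    NE5 EA EB W κ θ' ((G / (1 - ρ₀) * (δ + δ') + B) * (θ' - ω) / (θ' - (ω + G / (1 - ρ₀) * (cI * ε₁)))) :=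
  ne5_of_leaves_fibre M l01 l02 l03 l04op l04hist l05 l06 l07 l08 l09aff l09blind l09hom l09unit hE₁ hG hδ hθ hθθ' hθ'1
    (mul_nonneg hcI hε₁) hω hρ₀ l10near hB l10first (smallness_of_eps hρ₀ hsmall)

/-- **E1 AT GAIN `cI·ε₁` WITH L11 := ε₁-SMALLNESS** — `LeafIndex.ne5_of_leaves` BY NAME with `l11 : ω + Λ·c < θ′` replaced by
`Λ·cI·ε₁ < θ′ − ω` (consumed currency, one modulus `Λ`). [folklore] -/
theorem ne5_of_leaves_eps {EA : Functional C C.BgA} {EB : Functional C C.BgB} {W : Set (ℕ → ℝ)}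
    {κ Λ EA₀ E₀ δ δ' θ θ' cI ε₁ ω ρ₀ B : ℝ} {k₀ : ℕ} (l01 : L01 M EA W) (l02 : L02 M EB W) (l03 : L03 M EB W)
    (l04 : L04 M W κ Λ ρ₀) (l05 : L05 EA W EA₀ κ) (l06 : L06 EB W E₀ κ) (l07 : L07 M W δ θ) (l08 : L08 M W κ E₀ δ' θ)
    (l09 : L09 M W κ (cI * ε₁) ω) (hΛ : 0 ≤ Λ) (hδ : 0 ≤ δ + δ') (hθ : 0 ≤ θ) (hθθ' : θ ≤ θ') (hθ'1 : θ' ≤ 1) (hcI : 0 ≤ cI)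
    (hε₁ : 0 ≤ ε₁) (hω : 0 < ω) (l10near : (δ + δ') * θ ^ k₀ + cI * ε₁ * (EA₀ + E₀) / (1 - ω) ≤ ρ₀) (hB : 0 ≤ B)
    (l10first : ∀ k < k₀, EA₀ + E₀ ≤ B * θ ^ k) (hsmall : Λ * cI * ε₁ < θ' - ω) :
    NE5 EA EB W κ θ' ((Λ * (δ + δ') + B) * (θ' - ω) / (θ' - (ω + Λ * (cI * ε₁)))) :=
  ne5_of_leaves M l01 l02 l03 l04 l05 l06 l07 l08 l09 hΛ hδ hθ hθθ' hθ'1 (mul_nonneg hcI hε₁) hω l10near hB l10first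
    (smallnessMod_of_eps hsmall)

/-- **E1 FULLY DISCHARGED ON THE ARITHMETIC SIDE**: leaves L01–L09 at gain `cI·ε₁`, a genuine input rate `0 < θ < 1`, and the TWO
ε₁-conditions (reach `cI·ε₁·(EA₀+E₀) < ρ₀(1−ω)`, rate `Λ·cI·ε₁ < θ′ − ω`) give NE5 at `θ′` with SOME constant — L10's `k₀`, `B` come from
`OutputRateArithmetic.reach_binders_exists`. [folklore] -/
theorem exists_ne5_of_leaves_eps {EA : Functional C C.BgA} {EB : Functional C C.BgB} {W : Set (ℕ → ℝ)}
    {κ Λ EA₀ E₀ δ δ' θ θ' cI ε₁ ω ρ₀ : ℝ} (l01 : L01 M EA W) (l02 : L02 M EB W) (l03 : L03 M EB W)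
    (l04 : L04 M W κ Λ ρ₀) (l05 : L05 EA W EA₀ κ) (l06 : L06 EB W E₀ κ) (l07 : L07 M W δ θ) (l08 : L08 M W κ E₀ δ' θ)
    (l09 : L09 M W κ (cI * ε₁) ω) (hΛ : 0 ≤ Λ) (hδ : 0 ≤ δ + δ') (hθ0 : 0 < θ) (hθ1 : θ < 1) (hθθ' : θ ≤ θ')
    (hθ'1 : θ' ≤ 1) (hcI : 0 ≤ cI) (hε₁ : 0 ≤ ε₁) (hω : 0 < ω) (hω1 : ω < 1)
    (hreach : cI * ε₁ * (EA₀ + E₀) < ρ₀ * (1 - ω)) (hsmall : Λ * cI * ε₁ < θ' - ω) : ∃ C₅, NE5 EA EB W κ θ' C₅ := by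
  obtain ⟨k₀, B, hB, hnear, hfirst⟩ := reach_binders_exists hδ hθ0 hθ1 (reach_of_eps hω1 hreach)
  exact ⟨_, ne5_of_leaves_eps M l01 l02 l03 l04 l05 l06 l07 l08 l09 hΛ hδ hθ0.le hθθ' hθ'1 hcI hε₁ hω hnear hB hfirst hsmall⟩

/-- **«ε₁ SUFFICIENTLY SMALL» AS A KERNEL SENTENCE** (the booking of L10 ∧ L11 this file records): fix the route's letters — modulus
`Λ ≥ 0`, gain coefficient `cI ≥ 0`, levels `EA₀ + E₀ ≥ 0`, input rate `0 < θ < 1`, target `θ ≤ θ′ ≤ 1` with `ω < θ′`, age damping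
`0 < ω < 1`, reach `0 < ρ₀ < 1`.  Then there is ONE `ε⋆ > 0` such that FOR EVERY `0 ≤ ε₁ < ε⋆`, any two-run step model carrying the
leaves L01–L09 at insertion gain `cI·ε₁` satisfies NE5 at `θ′` with some constant.  (Quantifier order: ε⋆ depends on the letters only,
not on the model.) [folklore] -/
theorem eventually_ne5_of_leaves {Λ EA₀ E₀ δ δ' θ θ' cI ω ρ₀ : ℝ} (hΛ : 0 ≤ Λ) (hcI : 0 ≤ cI) (hE : 0 ≤ EA₀ + E₀)
    (hδ : 0 ≤ δ + δ') (hθ0 : 0 < θ) (hθ1 : θ < 1) (hθθ' : θ ≤ θ') (hθ'1 : θ' ≤ 1) (hωθ' : ω < θ') (hω : 0 < ω)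
    (hω1 : ω < 1) (hρ₀0 : 0 < ρ₀) (hρ₀1 : ρ₀ < 1) :
    ∃ εs : ℝ, 0 < εs ∧ ∀ ε₁, 0 ≤ ε₁ → ε₁ < εs →
      ∀ {EA : Functional C C.BgA} {EB : Functional C C.BgB} {W : Set (ℕ → ℝ)} {κ : ℝ},
        L01 M EA W → L02 M EB W → L03 M EB W → L04 M W κ Λ ρ₀ → L05 EA W EA₀ κ → L06 EB W E₀ κ → L07 M W δ θ →
        L08 M W κ E₀ δ' θ → L09 M W κ (cI * ε₁) ω → ∃ C₅, NE5 EA EB W κ θ' C₅ := by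
  -- `eps_threshold` at `G := Λ`; its rate half `Λ·cI·ε₁ < (θ′ − ω)(1 − ρ₀)` implies the consumed `Λ·cI·ε₁ < θ′ − ω`.
  obtain ⟨hpos, hall⟩ := eps_threshold hΛ hcI hE hωθ' hω1 hρ₀0 hρ₀1
  refine ⟨_, hpos, fun ε₁ hε₁ hε EA EB W κ l01 l02 l03 l04 l05 l06 l07 l08 l09 => ?_⟩
  obtain ⟨hrate, hreach⟩ := hall ε₁ hε
  have hrate' : Λ * cI * ε₁ < θ' - ω := by
    have h1 : (θ' - ω) * (1 - ρ₀) ≤ θ' - ω := by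
      have := sub_pos.mpr hωθ'
      nlinarith
    exact lt_of_lt_of_le hrate h1
  exact exists_ne5_of_leaves_eps M l01 l02 l03 l04 l05 l06 l07 l08 l09 hΛ hδ hθ0 hθ1 hθθ' hθ'1 hcI hε₁ hω hω1 hreach hrate'

end Faces

end Summit.QuantumFields.BalabanUV.T4Continuum.Spine.NE5
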